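import Mathlib
import HarnessLib.Audit
import Summits.PneNP.PneNP.Theorems.PstarSkeletonSpan

/-!
# No centre at maximal sharing: X-connected terminal cores with `2·#sharedSlots = #K` are centre-free inside the induction (ROUND-24, O1; all `s`, all `k`; memo g25 §44)

FRONTIER range-avoidance ladder, rung F-N3, ROUND 24 (cell `pnp-ideate`, prover-2 memo `g25/O1-XORSPLIT-g25.md` §44; typed targets
`PstarCoreBoundTargets.TerminalFive` / `TerminalPeelable` / `TerminalFiveMaxSharing` (p646951); restricted-model proof complexity — nothing here bears
on `P` versus `NP`).

**`no_centre_at_max_sharing`.**  Inside the core-bound induction (proper terminal sub-cores have at most five members), an X-connected terminal core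
`K` at MAXIMAL SHARING `2·#sharedSlots K = #K` (the extreme case of `PstarSharingBound.two_mul_card_sharedSlots_le`; the `t = 0` layer of the
planner's census for EVERY sharing pattern `s`, not only `s = 6`) carries no non-empty leafless set of non-chords.  Proof (counting only, given the
landed structure theorems):
1. maximal sharing forces `2·#bdry K = 3·#K` (`card_bdry_add_card_sharedSlots_le` + expansion): the boundary slack is `0`, so there is NO dirty
   chord (`PstarChordReadTwoCleanCount.card_dirty_le_slack`) and the skeleton is the set of non-chords;
2. hence (`PstarSkeletonSpan.card_xverts_le_card_skel`, X-connected, centre) `u := #xverts K ≤ #nonchords ≤ #sharedSlots = #K/2 ≤ #chords`;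
3. for every chord `c`, expansion of `K ∖ c` against the tight boundary `#bdry K = 3#K/2` forces an XOR endpoint of `c` read by exactly two
   members of `K` (`bdry_erase_subset`): `c` and — by `covered_of_terminal` — a non-chord; this endpoint is not a vertex of the centre (centre
   vertices carry two non-chords), and distinct chords get distinct endpoints;
4. so `#chords ≤ u − 1 < u ≤ #chords`.
-/

set_option linter.dupNamespace false -- `Summit.PneNP.PneNP.…`: summit = sub-problem name (D-0017 single-conjunct layout)

open Finset Literature.Computability.Complexity
open Summit.PneNP.PneNP.Theorems.PstarTyped (Typed)
open Summit.PneNP.PneNP.Theorems.PstarSALevel (varSet bdry BoundaryExpanding SimpleOverlap)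
open Summit.PneNP.PneNP.Theorems.PstarSAClosure (degIn mem_bdry_iff)
open Summit.PneNP.PneNP.Theorems.PstarXCore (xpair mem_xpair xverts)
open Summit.PneNP.PneNP.Theorems.PstarCentreFree (vars_mem_varSet)
open Summit.PneNP.PneNP.Theorems.PstarCoreBound (XorClosed)
open Summit.PneNP.PneNP.Theorems.PstarChordRepair (IsChord)
open Summit.PneNP.PneNP.Theorems.PstarCoreBoundTargets (Terminal nonchords mem_nonchords nonchords_subset)
open Summit.PneNP.PneNP.Theorems.PstarSharingBound (sharedSlots card_bdry_add_card_sharedSlots_le)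
open Summit.PneNP.PneNP.Theorems.PstarChordBridgeTools (xpdeg)
open Summit.PneNP.PneNP.Theorems.PstarChordBridgeExchange (mem_xverts_iff)
open Summit.PneNP.PneNP.Theorems.PstarNorUnitCoverTools (exists_ne_of_two_le_xpdeg)
open Summit.PneNP.PneNP.Theorems.PstarChordReadOutside (OutsideGated)
open Summit.PneNP.PneNP.Theorems.PstarChordReadTwoCleanCount (card_dirty_le_slack)
open Summit.PneNP.PneNP.Theorems.PstarCleanChordCount (card_nonchords_le_card_sharedSlots)
open Summit.PneNP.PneNP.Theorems.PstarNoFreeVertex (covered_of_terminal mem_varSet_of_mem_xpair)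
open Summit.PneNP.PneNP.Theorems.PstarSkeletonSpan (XConnected skel mem_skel card_xverts_le_card_skel xverts_mono)

namespace Summit.PneNP.PneNP.Theorems.PstarMaxSharingCentre

variable {n m : ℕ}

/-! ## Deleting a chord from a family: the boundary -/

/-- `degIn` of the family with one member erased. -/
theorem degIn_erase (I : LocalMap 4 n m) {K : Finset (Fin m)} {c : Fin m} (hc : c ∈ K) (v : Fin n) :
    degIn I K v = degIn I (K.erase c) v + (if v ∈ varSet I c then 1 else 0) := by
  classical
  unfold PstarSAClosure.degIn
  rw [← insert_erase hc, filter_insert, insert_erase hc]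
  by_cases hv : v ∈ varSet I c
  · rw [if_pos hv, if_pos hv, card_insert_of_notMem fun h => (mem_erase.1 (mem_filter.1 h).1).1 rfl]
  · rw [if_neg hv, if_neg hv, add_zero]

/-- **Deleting a CHORD**: the boundary of `K ∖ c` lies in `bdry K` minus the two AND-privates of `c`, plus the XOR endpoints of `c` read by exactly
two members of `K`. -/
theorem bdry_erase_subset (I : LocalMap 4 n m) {K : Finset (Fin m)} {c : Fin m} (hc : c ∈ K) (hch : IsChord I K c) :
    bdry I (K.erase c) ⊆ (bdry I K \ {I.vars c 2, I.vars c 3}) ∪ (xpair I c).filter fun w => degIn I K w = 2 := by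
  classical
  intro v hv
  rw [mem_bdry_iff] at hv
  have hdeg := degIn_erase I hc v
  rw [hv] at hdeg
  rw [mem_union]
  by_cases hvc : v ∈ varSet I c
  · rw [if_pos hvc] at hdeg
    right
    rw [mem_filter]
    refine ⟨?_, hdeg⟩
    -- `v` is an XOR variable of `c`: its AND variables are private in `K` (degree one)
    unfold PstarSALevel.varSet at hvc
    obtain ⟨s, -, hs⟩ := mem_image.1 hvc
    have h4 : ∀ t : Fin 4, t = 0 ∨ t = 1 ∨ t = 2 ∨ t = 3 := by decide
    rcases h4 s with rfl | rfl | rfl | rfl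
    · exact (mem_xpair I).2 (Or.inl hs.symm)
    · exact (mem_xpair I).2 (Or.inr hs.symm)
    · exfalso
      have h1 := (mem_bdry_iff I K _).1 hch.1
      rw [hs] at h1
      omega
    · exfalso
      have h1 := (mem_bdry_iff I K _).1 hch.2
      rw [hs] at h1
      omega
  · rw [if_neg hvc, add_zero] at hdeg
    left
    rw [mem_sdiff, mem_bdry_iff]
    refine ⟨hdeg, fun h => hvc ?_⟩
    rcases mem_insert.1 h with h | h
    · rw [h]; exact vars_mem_varSet I c 2
    · rw [mem_singleton.1 h]; exact vars_mem_varSet I c 3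

/-- Hence `#bdry (K ∖ c) + 2 ≤ #bdry K + #{endpoints of c of degree two}`. -/
theorem card_bdry_erase_le (I : LocalMap 4 n m) (hI : I.IsPure xorAndPred) {K : Finset (Fin m)} {c : Fin m} (hc : c ∈ K) (hch : IsChord I K c) :
    (bdry I (K.erase c)).card + 2 ≤ (bdry I K).card + ((xpair I c).filter fun w => degIn I K w = 2).card := by
  classical
  have h23 : I.vars c 2 ≠ I.vars c 3 := fun h => absurd (hI.2 c h) (by decide)
  have hsub : ({I.vars c 2, I.vars c 3} : Finset (Fin n)) ⊆ bdry I K := by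
    intro v hv
    rcases mem_insert.1 hv with rfl | hv
    · exact hch.1
    · rw [mem_singleton.1 hv]; exact hch.2
  have hpair : ({I.vars c 2, I.vars c 3} : Finset (Fin n)).card = 2 := card_pair h23
  have h1 := (card_le_card (bdry_erase_subset I hc hch)).trans (card_union_le _ _)
  rw [card_sdiff_of_subset hsub, hpair] at h1
  have h2 : 2 ≤ (bdry I K).card := hpair ▸ card_le_card hsub
  omega

/-! ## The theorem -/

variable {I : LocalMap 4 n m} {r : ℕ} {y : Fin m → Bool} {K : Finset (Fin m)} {w₁ w₂ : Finset (Fin n) × Finset (Fin m) × Bool}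

/-- **NO CENTRE AT MAXIMAL SHARING** (all sharing patterns, all core sizes; inside the core-bound induction).  An X-connected terminal core `K` of a
pure typed `(r,3/2)`-expanding instance with simple overlaps with `2·#sharedSlots K = #K` has no non-empty leafless set of non-chords. -/
theorem no_centre_at_max_sharing (hI : I.IsPure xorAndPred) (hT : Typed I) (hS : SimpleOverlap I) (hB : BoundaryExpanding r I)
    (ht : Terminal I r y K w₁ w₂)
    (hIH : ∀ c ∈ K, ∀ K₀ ⊆ K.erase c, ∀ d d' : Finset (Fin n) × Finset (Fin m) × Bool, Terminal I r y K₀ d d' → K₀.card ≤ 5)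
    (hconn : XConnected I K) (hmax : 2 * (sharedSlots I K).card = K.card) :
    ¬ ∃ S ⊆ K, S.Nonempty ∧ (∀ w ∈ xverts I S, 2 ≤ xpdeg I S w) ∧ ∀ f ∈ S, ¬ IsChord I K f := by
  classical
  rintro ⟨S, hSK, hSne, hSL, hSnc⟩
  have hX : XorClosed I K := ht.2.1
  have hKr : K.card < r := ht.2.2.1
  set M := w₁.2.1 ∪ w₂.2.1 with hM
  -- (1) the boundary is tight: no dirty chord
  have hexp : 3 * K.card ≤ 2 * (bdry I K).card := hB K hKr.le
  have hbs := card_bdry_add_card_sharedSlots_le I K hX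
  have htight : 2 * (bdry I K).card = 3 * K.card := by omega
  have clean : ∀ c ∈ K, IsChord I K c → OutsideGated I K M c := by
    intro c hc hch
    by_contra hO
    have h := card_dirty_le_slack hB ht (t := 0) (by omega) (𝒟 := {c}) (singleton_subset_iff.2 hc)
      (fun c' hc' => by rw [mem_singleton.1 hc']; exact hch) (fun c' hc' => by rw [mem_singleton.1 hc']; exact hO)
    rw [card_singleton] at h
    omega
  -- (2) the skeleton is the set of non-chords; `u ≤ #nonchords ≤ #sharedSlots`, so `u ≤ #chords`
  have hskel : skel I K M ⊆ nonchords I K := by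
    intro f hf
    obtain ⟨hfK, hnot⟩ := (mem_skel I).1 hf
    exact (mem_nonchords I).2 ⟨hfK, fun hch => hnot ⟨hch, clean f hfK hch⟩⟩
  have hu : (xverts I K).card ≤ (nonchords I K).card :=
    (card_xverts_le_card_skel hI hT hS hB ht hIH hconn ⟨S, hSK, hSne, hSL, hSnc⟩).trans (card_le_card hskel)
  have hN := card_nonchords_le_card_sharedSlots I K
  set C := K.filter fun c => IsChord I K c with hC
  have hsplit : C.card + (nonchords I K).card = K.card := by
    have h := card_filter_add_card_filter_not (s := K) (fun c => IsChord I K c)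
    have e : (K.filter fun c => ¬ IsChord I K c) = nonchords I K := by
      ext f; rw [mem_filter, mem_nonchords]
    rw [e] at h
    exact h
  have hCu : (xverts I K).card ≤ C.card := by omega
  -- (3) every chord has an XOR endpoint of degree two in `K`; choose one
  have hdeg2 : ∀ c ∈ C, ∃ w ∈ xpair I c, degIn I K w = 2 := by
    intro c hc
    obtain ⟨hcK, hch⟩ := mem_filter.1 hc
    have h1 := card_bdry_erase_le I hI hcK hch
    have h2 : 3 * (K.erase c).card ≤ 2 * (bdry I (K.erase c)).card := hB _ ((card_le_card (erase_subset c K)).trans hKr.le)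
    rw [card_erase_of_mem hcK] at h2
    have hpos : 0 < ((xpair I c).filter fun w => degIn I K w = 2).card := by
      have hk : 1 ≤ K.card := card_pos.2 ⟨c, hcK⟩
      omega
    obtain ⟨w, hw⟩ := card_pos.1 hpos
    exact ⟨w, (mem_filter.1 hw).1, (mem_filter.1 hw).2⟩
  choose φ hφx hφd using hdeg2
  -- members reading a degree-two XOR endpoint of a chord: the chord and one non-chord
  have readers : ∀ c (hc : c ∈ C), ∀ g ∈ K, φ c hc ∈ xpair I g → g = c ∨ ¬ IsChord I K g := by
    intro c hc g hg hwg
    by_contra hne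
    push Not at hne
    obtain ⟨hgc, hgch⟩ := hne
    obtain ⟨hcK, -⟩ := mem_filter.1 hc
    -- a non-chord through the vertex (covered; all chords are clean)
    have hwK : φ c hc ∈ xverts I K := (mem_xverts_iff I K _).2 ⟨c, hcK, hφx c hc⟩
    obtain ⟨f, hf, hwf, hnot⟩ := covered_of_terminal hI hT hS hB ht (φ c hc) hwK
    have hfnc : ¬ IsChord I K f := fun h => hnot ⟨h, clean f hf h⟩
    have hfc : f ≠ c := fun h => hfnc (h ▸ (mem_filter.1 hc).2)
    have hfg : f ≠ g := fun h => hfnc (h ▸ hgch)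
    -- three distinct readers of a degree-two variable
    have h3 : 3 ≤ degIn I K (φ c hc) := by
      unfold PstarSAClosure.degIn
      have hsub : ({c, g, f} : Finset (Fin m)) ⊆ K.filter fun j => φ c hc ∈ varSet I j := by
        intro j hj
        rw [mem_filter]
        rcases mem_insert.1 hj with rfl | hj
        · exact ⟨hcK, mem_varSet_of_mem_xpair (hφx j hc)⟩
        rcases mem_insert.1 hj with rfl | hj
        · exact ⟨hg, mem_varSet_of_mem_xpair hwg⟩
        · rw [mem_singleton.1 hj]; exact ⟨hf, mem_varSet_of_mem_xpair hwf⟩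
      have hcard : ({c, g, f} : Finset (Fin m)).card = 3 := by
        rw [card_insert_of_notMem, card_pair hfg.symm]
        rw [mem_insert, mem_singleton]; push Not; exact ⟨hgc.symm, hfc.symm⟩
      exact hcard ▸ card_le_card hsub
    have := hφd c hc
    omega
  -- `φ` is injective on `C`
  have hinj : ∀ c₁ (h₁ : c₁ ∈ C) c₂ (h₂ : c₂ ∈ C), φ c₁ h₁ = φ c₂ h₂ → c₁ = c₂ := by
    intro c₁ h₁ c₂ h₂ heq
    rcases readers c₁ h₁ c₂ (mem_filter.1 h₂).1 (heq ▸ hφx c₂ h₂) with h | h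
    · exact h.symm
    · exact absurd (mem_filter.1 h₂).2 h
  -- `φ` avoids the vertices of the centre `S`
  have havoid : ∀ c (hc : c ∈ C), φ c hc ∉ xverts I S := by
    intro c hc hwS
    have h2 := hSL _ hwS
    obtain ⟨f, hf, -, hwf⟩ := exists_ne_of_two_le_xpdeg I hI c h2
    obtain ⟨f', hf', hf'f, hwf'⟩ := exists_ne_of_two_le_xpdeg I hI f h2
    obtain ⟨hcK, hch⟩ := mem_filter.1 hc
    have hfc : f ≠ c := fun h => hSnc f hf (h ▸ hch)
    have hf'c : f' ≠ c := fun h => hSnc f' hf' (h ▸ hch)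
    have h3 : 3 ≤ degIn I K (φ c hc) := by
      unfold PstarSAClosure.degIn
      have hsub : ({c, f, f'} : Finset (Fin m)) ⊆ K.filter fun j => φ c hc ∈ varSet I j := by
        intro j hj
        rw [mem_filter]
        rcases mem_insert.1 hj with rfl | hj
        · exact ⟨hcK, mem_varSet_of_mem_xpair (hφx j hc)⟩
        rcases mem_insert.1 hj with rfl | hj
        · exact ⟨hSK hf, mem_varSet_of_mem_xpair hwf⟩
        · rw [mem_singleton.1 hj]; exact ⟨hSK hf', mem_varSet_of_mem_xpair hwf'⟩
      have hcard : ({c, f, f'} : Finset (Fin m)).card = 3 := by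
        rw [card_insert_of_notMem, card_pair hf'f.symm]
        rw [mem_insert, mem_singleton]; push Not; exact ⟨hfc.symm, hf'c.symm⟩
      exact hcard ▸ card_le_card hsub
    have := hφd c hc
    omega
  -- (4) count: `#C ≤ #(xverts K ∖ xverts S) ≤ u − 1`
  set T := xverts I K \ xverts I S with hTdef
  have himg : ∀ c (hc : c ∈ C), φ c hc ∈ T := fun c hc =>
    mem_sdiff.2 ⟨(mem_xverts_iff I K _).2 ⟨c, (mem_filter.1 hc).1, hφx c hc⟩, havoid c hc⟩
  have hCT : C.card ≤ T.card := by
    refine card_le_card_of_injOn (fun c => if hc : c ∈ C then φ c hc else I.vars c 0) (fun c hc => ?_) ?_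
    · simp only [dif_pos (mem_coe.1 hc)]; exact himg c hc
    · intro c₁ h₁ c₂ h₂ heq
      have h₁' : c₁ ∈ C := mem_coe.1 h₁
      have h₂' : c₂ ∈ C := mem_coe.1 h₂
      simp only [dif_pos h₁', dif_pos h₂'] at heq
      exact hinj c₁ h₁' c₂ h₂' heq
  have hSx : (xverts I S).Nonempty := by
    obtain ⟨s, hs⟩ := hSne
    exact ⟨I.vars s 0, (mem_xverts_iff I S _).2 ⟨s, hs, (mem_xpair I).2 (Or.inl rfl)⟩⟩
  have hTcard : T.card + (xverts I S).card = (xverts I K).card := by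
    rw [hTdef, card_sdiff_add_card_eq_card (xverts_mono I hSK)]
  have hSpos : 0 < (xverts I S).card := card_pos.2 hSx
  omega

end Summit.PneNP.PneNP.Theorems.PstarMaxSharingCentre
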